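import Mathlib.GroupTheory.Index
import Mathlib.GroupTheory.Sylow
import Mathlib.Tactic.Group
import HarnessLib

/-!
# Admissible halves of a finite group from a subgroup of index two (the one-swap and two-swap constructions)

COR-CM (cell `pub-hodgecm2`), binder seat b04 (gen 24), count-neutral claim REAL-FACTOR, part I (pure group theory,
Mathlib only).  KERNEL ONLY: theorems; no definition, no named fact, no `sorry`.  `HC_CM` is neither used nor claimed.

An ADMISSIBLE HALF of a finite group `H` is a subset `A ⊆ H` with `2|A| = |H|` which is APERIODIC (`aA = A ⟹ a = 1`,
stated as `∀ a ≠ 1, ∃ q, ¬ (q ∈ A ↔ a q ∈ A)`) and NOWHERE SELF-COMPLEMENTARY (`aA ≠ H ∖ A`, stated as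
`∀ a, ∃ q, (q ∈ A ↔ a q ∈ A)`) — exactly the hypotheses of gen 23's TWO-FIBRE criterion
`GaloisModels.exists_simple_degenerate_of_model_twoFibre` (`CorCM/GaloisQuaternionCompositum`): for a compositum
`K = M·L` of a totally real Galois field `M` with group `H` and a Galois CM field `L` with a primitive CM type, an
admissible half of `H` yields a primitive DEGENERATE CM type of `K`.

This file constructs admissible halves from a subgroup `B ≤ H` of index `2`:

* §2 **one swap** (`exists_half_of_index_two_swap`): `A = (B ∖ {b₀}) ∪ {x₀}` (`1 ≠ b₀ ∈ B`, `x₀ ∉ B`, `|B| ≥ 3`) is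
  admissible iff `x₀ b₀⁻¹` is not an involution; hence (`exists_half_of_index_two_of_mul_self_ne_one`) an admissible
  half exists as soon as some element outside `B` is not an involution.
* §3 **two swaps** (`exists_half_of_index_two`): `A = (B ∖ {b₀, b₀u}) ∪ {x₀, x₀v}` with
  `v ∉ {1, u, u⁻¹, x₀⁻¹ b₀ u⁻¹ b₀⁻¹ x₀}` is ALWAYS admissible — so every finite group with a subgroup of index `2` and
  order `≥ 5` has an admissible half (no hypothesis on involutions: the generalised dihedral groups `Dih(B)`, e.g.
  `D_p`, and the elementary abelian `C₂ᵏ`, `k ≥ 4`, included).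
* §4 corollaries: groups of order `2k` with an element of order `k ≥ 5` (`exists_half_of_orderOf`), of order `2p`
  for a prime `p ≥ 5` (`exists_half_of_card_eq_two_mul_prime`: `C_{2p}`, `D_p`), and the groups of exponent `2`
  and order `≥ 16` (`exists_half_of_exponent_two`).

No admissible half exists in `C₂, C₄, C₂², S₃, C₂³` (gen 23 census); both constructions were checked exhaustively on
31 groups of order `6 … 24` (`scratch/g24a.py`, 0 failures).

## References

* [Shimura1998] G. Shimura, *Abelian Varieties with Complex Multiplication and Modular Functions*, §8.2 Prop. 26.
* [Dodson1984] B. Dodson, *The structure of Galois groups of CM-fields*, Trans. AMS 283 (1984), §3.1.1.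
-/

namespace Summit.HodgeConjecture.CorCM.AdmissibleHalves

variable {H : Type*} [Group H] [Fintype H]

/-! ## §1 Helpers on a subgroup of index two -/

/-- A subgroup with at least three elements has an element different from two given ones. [folklore] -/
theorem exists_mem_ne_two {B : Subgroup H} (h3 : 3 ≤ Nat.card B) (a₁ a₂ : H) :
    ∃ q ∈ B, q ≠ a₁ ∧ q ≠ a₂ := by
  classical
  have hcard : (Finset.univ.filter fun g : H => g ∈ B).card = Nat.card B := by
    rw [Nat.card_eq_fintype_card, ← Fintype.card_subtype]
  have hlt : ({a₁, a₂} : Finset H).card < (Finset.univ.filter fun g : H => g ∈ B).card :=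
    lt_of_le_of_lt Finset.card_le_two (by rw [hcard]; omega)
  obtain ⟨q, hq, hqn⟩ := Finset.exists_mem_notMem_of_card_lt_card hlt
  simp only [Finset.mem_filter, Finset.mem_univ, true_and, Finset.mem_insert, Finset.mem_singleton, not_or] at hq hqn
  exact ⟨q, hq, hqn.1, hqn.2⟩

/-- A subgroup with at least five elements has an element different from four given ones. [folklore] -/
theorem exists_mem_ne_four {B : Subgroup H} (h5 : 5 ≤ Nat.card B) (a₁ a₂ a₃ a₄ : H) :
    ∃ q ∈ B, q ≠ a₁ ∧ q ≠ a₂ ∧ q ≠ a₃ ∧ q ≠ a₄ := by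
  classical
  have hcard : (Finset.univ.filter fun g : H => g ∈ B).card = Nat.card B := by
    rw [Nat.card_eq_fintype_card, ← Fintype.card_subtype]
  have hlt : ({a₁, a₂, a₃, a₄} : Finset H).card < (Finset.univ.filter fun g : H => g ∈ B).card :=
    lt_of_le_of_lt Finset.card_le_four (by rw [hcard]; omega)
  obtain ⟨q, hq, hqn⟩ := Finset.exists_mem_notMem_of_card_lt_card hlt
  simp only [Finset.mem_filter, Finset.mem_univ, true_and, Finset.mem_insert, Finset.mem_singleton, not_or] at hq hqn
  exact ⟨q, hq, hqn.1, hqn.2.1, hqn.2.2.1, hqn.2.2.2⟩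

omit [Fintype H] in
/-- A subgroup of index `2` misses some element. [folklore] -/
theorem exists_not_mem_of_index_two {B : Subgroup H} (hB : B.index = 2) : ∃ x : H, x ∉ B := by
  by_contra h
  push Not at h
  have htop : B = ⊤ := (Subgroup.eq_top_iff' B).2 h
  rw [← Subgroup.index_eq_one, hB] at htop
  exact absurd htop (by norm_num)

/-- `2 · |B| = |H|` for a subgroup of index `2`. [folklore] -/
theorem two_mul_card_of_index_two {B : Subgroup H} (hB : B.index = 2) : 2 * Nat.card B = Fintype.card H := by
  rw [← Nat.card_eq_fintype_card, ← B.index_mul_card, hB]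

/-! ## §2 One swap: `A = (B ∖ {b₀}) ∪ {x₀}` -/

/-- **ONE SWAP.**  `B ≤ H` of index `2` with `|B| ≥ 3`, `1 ≠ b₀ ∈ B`, `x₀ ∉ B` with `(x₀ b₀⁻¹)² ≠ 1`: the half
`A = (B ∖ {b₀}) ∪ {x₀}` is admissible — `2|A| = |H|`, aperiodic, nowhere self-complementary.  (Conversely, if
`x₀ b₀⁻¹` is an involution then `(x₀ b₀⁻¹) A = H ∖ A`; not needed here.) [folklore] -/
theorem exists_half_of_index_two_swap {B : Subgroup H} (hB : B.index = 2) (h3 : 3 ≤ Nat.card B) {b₀ x₀ : H}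
    (hb₀ : b₀ ∈ B) (hb₀1 : b₀ ≠ 1) (hx₀ : x₀ ∉ B) (hy : x₀ * b₀⁻¹ * (x₀ * b₀⁻¹) ≠ 1) :
    ∃ A : Finset H, 2 * A.card = Fintype.card H ∧ (∀ a : H, a ≠ 1 → ∃ q, ¬ (q ∈ A ↔ a * q ∈ A)) ∧
      (∀ a : H, ∃ q, (q ∈ A ↔ a * q ∈ A)) := by
  classical
  have hidx : ∀ a b : H, a * b ∈ B ↔ (a ∈ B ↔ b ∈ B) := fun a b => Subgroup.mul_mem_iff_of_index_two hB
  set A : Finset H := insert x₀ ((Finset.univ.filter fun g : H => g ∈ B).erase b₀) with hA_def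
  have hmem : ∀ q, q ∈ A ↔ q = x₀ ∨ (q ≠ b₀ ∧ q ∈ B) := fun q => by
    rw [hA_def, Finset.mem_insert, Finset.mem_erase, Finset.mem_filter]
    simp only [Finset.mem_univ, true_and]
  have h1A : (1 : H) ∈ A := (hmem 1).2 (Or.inr ⟨fun h => hb₀1 h.symm, B.one_mem⟩)
  have hx₀A : x₀ ∈ A := (hmem x₀).2 (Or.inl rfl)
  have hb₀A : b₀ ∉ A := fun h => by
    rcases (hmem b₀).1 h with h | h
    · exact hx₀ (h ▸ hb₀)
    · exact h.1 rfl
  have hBA : ∀ q ∈ B, q ≠ b₀ → q ∈ A := fun q hq hqb => (hmem q).2 (Or.inr ⟨hqb, hq⟩)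
  have hout : ∀ q, q ∉ B → q ≠ x₀ → q ∉ A := fun q hq hqx h => by
    rcases (hmem q).1 h with h | h
    · exact hqx h
    · exact hq h.2
  refine ⟨A, ?_, fun a ha1 => ?_, fun a => ?_⟩
  · -- cardinality
    have hcardB : (Finset.univ.filter fun g : H => g ∈ B).card = Nat.card B := by
      rw [Nat.card_eq_fintype_card, ← Fintype.card_subtype]
    have hx₀e : x₀ ∉ (Finset.univ.filter fun g : H => g ∈ B).erase b₀ := fun h => by
      rw [Finset.mem_erase, Finset.mem_filter] at h
      exact hx₀ h.2.2
    have hb₀f : b₀ ∈ (Finset.univ.filter fun g : H => g ∈ B) := Finset.mem_filter.2 ⟨Finset.mem_univ _, hb₀⟩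
    rw [hA_def, Finset.card_insert_of_notMem hx₀e, Finset.card_erase_of_mem hb₀f, hcardB,
      ← two_mul_card_of_index_two hB]
    omega
  · -- aperiodic
    by_cases haA : a ∈ A
    · rcases (hmem a).1 haA with rfl | ⟨hab, haB⟩
      · -- `a = x₀`: some `q ∈ B ∖ {1, b₀}` has `x₀ q ∉ A`
        obtain ⟨q, hqB, hq1, hqb⟩ := exists_mem_ne_two h3 (1 : H) b₀
        refine ⟨q, fun h => ?_⟩
        have hq : a * q ∉ A := hout _ (fun hm => hx₀ (((hidx a q).1 hm).2 hqB))
          (fun he => hq1 (mul_left_cancel (he.trans (mul_one a).symm)))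
        exact hq (h.1 (hBA q hqB hqb))
      · -- `a ∈ B ∖ {1, b₀}`: `a x₀ ∉ A`
        refine ⟨x₀, fun h => ?_⟩
        have hq : a * x₀ ∉ A := hout _ (fun hm => hx₀ (((hidx a x₀).1 hm).1 haB))
          (fun he => ha1 (mul_right_cancel (he.trans (one_mul x₀).symm)))
        exact hq (h.1 hx₀A)
    · exact ⟨1, fun h => haA (by rw [mul_one] at h; exact h.1 h1A)⟩
  · -- nowhere self-complementary
    by_cases haA : a ∈ A
    · exact ⟨1, by rw [mul_one]; exact ⟨fun _ => haA, fun _ => h1A⟩⟩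
    by_cases haB : a ∈ B
    · -- `a = b₀`
      have hab : a = b₀ := by
        by_contra h; exact haA (hBA a haB h)
      subst hab
      obtain ⟨q, hqB, hq1, hqb⟩ := exists_mem_ne_two h3 (1 : H) a
      refine ⟨q, ⟨fun _ => hBA _ (B.mul_mem haB hqB) (fun he => hq1 ?_), fun _ => hBA q hqB hqb⟩⟩
      exact mul_left_cancel (he.trans (mul_one a).symm)
    · -- `a ∉ B`, `a ≠ x₀`
      have hax : a ≠ x₀ := fun h => haA (h ▸ hx₀A)
      by_cases h1 : a * x₀ = b₀
      · by_cases h2 : a * b₀ = x₀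
        · -- then `a = x₀ b₀⁻¹` is an involution: excluded
          exfalso
          have haa : a * a = 1 := by
            have h3' : a * a * b₀ = b₀ := by rw [mul_assoc, h2, h1]
            calc a * a = a * a * b₀ * b₀⁻¹ := by rw [mul_inv_cancel_right]
              _ = 1 := by rw [h3', mul_inv_cancel]
          have ha : x₀ * b₀⁻¹ = a := by rw [← h2, mul_inv_cancel_right]
          exact hy (by rw [ha, haa])
        · -- `q = b₀`: both `b₀ ∉ A` and `a b₀ ∉ A`
          refine ⟨b₀, ⟨fun h => absurd h hb₀A, fun h => absurd h (hout _ (fun hm => haB ?_) h2)⟩⟩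
          exact ((hidx a b₀).1 hm).2 hb₀
      · -- `q = x₀`: both in `A`
        exact ⟨x₀, ⟨fun _ => hBA _ ((hidx a x₀).2 ⟨fun h => absurd h haB, fun h => absurd h hx₀⟩) h1,
          fun _ => hx₀A⟩⟩

/-- One swap from a non-involution outside `B`: `B ≤ H` of index `2`, `|B| ≥ 3`, `y ∉ B` with `y² ≠ 1` ⟹ `H` has an
admissible half (`b₀ ∈ B ∖ {1}` arbitrary, `x₀ = y b₀`). [folklore] -/
theorem exists_half_of_index_two_of_mul_self_ne_one {B : Subgroup H} (hB : B.index = 2) (h3 : 3 ≤ Nat.card B)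
    {y : H} (hy : y ∉ B) (hy2 : y * y ≠ 1) :
    ∃ A : Finset H, 2 * A.card = Fintype.card H ∧ (∀ a : H, a ≠ 1 → ∃ q, ¬ (q ∈ A ↔ a * q ∈ A)) ∧
      (∀ a : H, ∃ q, (q ∈ A ↔ a * q ∈ A)) := by
  obtain ⟨b₀, hb₀, hb₀1, -⟩ := exists_mem_ne_two h3 (1 : H) 1
  refine exists_half_of_index_two_swap hB h3 hb₀ hb₀1 (x₀ := y * b₀)
    (fun h => hy (((Subgroup.mul_mem_iff_of_index_two hB).1 h).2 hb₀)) ?_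
  rw [mul_inv_cancel_right]
  exact hy2

/-! ## §3 Two swaps: `A = (B ∖ {b₀, b₀ u}) ∪ {x₀, x₀ v}` — every index-two subgroup of order `≥ 5` -/

/-- **TWO SWAPS — every finite group with a subgroup of index `2` and order `≥ 5` has an admissible half.**
With `1 ≠ b₀ ∈ B`, `u ∈ B ∖ {1, b₀⁻¹}`, `x₀ ∉ B` and `v ∈ B ∖ {1, u, u⁻¹, x₀⁻¹ b₀ u⁻¹ b₀⁻¹ x₀}` (possible as
`|B| ≥ 5`), the half `A = (B ∖ {b₀, b₀ u}) ∪ {x₀, x₀ v}` satisfies `2|A| = |H|`, is aperiodic and nowhere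
self-complementary.  No hypothesis on involutions: generalised dihedral groups `Dih(B)` (`D_p`, `p ≥ 5`) and
elementary abelian `C₂ᵏ` (`k ≥ 4`) are included. [folklore] -/
theorem exists_half_of_index_two {B : Subgroup H} (hB : B.index = 2) (h5 : 5 ≤ Nat.card B) :
    ∃ A : Finset H, 2 * A.card = Fintype.card H ∧ (∀ a : H, a ≠ 1 → ∃ q, ¬ (q ∈ A ↔ a * q ∈ A)) ∧
      (∀ a : H, ∃ q, (q ∈ A ↔ a * q ∈ A)) := by
  classical
  have hidx : ∀ a b : H, a * b ∈ B ↔ (a ∈ B ↔ b ∈ B) := fun a b => Subgroup.mul_mem_iff_of_index_two hB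
  have h3 : 3 ≤ Nat.card B := by omega
  -- the parameters
  obtain ⟨b₀, hb₀, hb₀1, -⟩ := exists_mem_ne_two h3 (1 : H) 1
  obtain ⟨u, hu, hu1, hub⟩ := exists_mem_ne_two h3 (1 : H) b₀⁻¹
  obtain ⟨x₀, hx₀⟩ := exists_not_mem_of_index_two hB
  obtain ⟨v, hv, hv1, hvu, hvu', hvw⟩ := exists_mem_ne_four h5 (1 : H) u u⁻¹ (x₀⁻¹ * b₀ * u⁻¹ * b₀⁻¹ * x₀)
  set b₁ : H := b₀ * u with hb₁_def
  set x₁ : H := x₀ * v with hx₁_def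
  have hb₁ : b₁ ∈ B := B.mul_mem hb₀ hu
  have hb₁1 : b₁ ≠ 1 := fun h => hub (eq_inv_of_mul_eq_one_right h)
  have hb₀₁ : b₀ ≠ b₁ := fun h => hu1 (mul_left_cancel (a := b₀) (by rw [mul_one]; exact h.symm))
  have hx₁ : x₁ ∉ B := fun h => hx₀ (((hidx x₀ v).1 h).2 hv)
  have hx₀₁ : x₀ ≠ x₁ := fun h => hv1 (mul_left_cancel (a := x₀) (by rw [mul_one]; exact h.symm))
  -- the half
  set A : Finset H :=
    insert x₀ (insert x₁ ((((Finset.univ.filter fun g : H => g ∈ B).erase b₀).erase b₁))) with hA_def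
  have hmem : ∀ q, q ∈ A ↔ q = x₀ ∨ q = x₁ ∨ (q ≠ b₁ ∧ q ≠ b₀ ∧ q ∈ B) := fun q => by
    rw [hA_def, Finset.mem_insert, Finset.mem_insert, Finset.mem_erase, Finset.mem_erase, Finset.mem_filter]
    simp only [Finset.mem_univ, true_and]
  have hBA : ∀ q ∈ B, q ≠ b₀ → q ≠ b₁ → q ∈ A := fun q hq h0 h1 => (hmem q).2 (Or.inr (Or.inr ⟨h1, h0, hq⟩))
  have hout : ∀ q, q ∉ B → q ≠ x₀ → q ≠ x₁ → q ∉ A := fun q hq h0 h1 h => by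
    rcases (hmem q).1 h with h | h | h
    · exact h0 h
    · exact h1 h
    · exact hq h.2.2
  have hAB : ∀ q ∈ A, q ∈ B → q ≠ b₀ ∧ q ≠ b₁ := fun q hqA hqB => by
    rcases (hmem q).1 hqA with h | h | h
    · exact absurd hqB (h ▸ hx₀)
    · exact absurd hqB (h ▸ hx₁)
    · exact ⟨h.2.1, h.1⟩
  have hAout : ∀ q ∈ A, q ∉ B → q = x₀ ∨ q = x₁ := fun q hqA hqB => by
    rcases (hmem q).1 hqA with h | h | h
    · exact Or.inl h
    · exact Or.inr h
    · exact absurd h.2.2 hqB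
  have h1A : (1 : H) ∈ A := hBA 1 B.one_mem hb₀1.symm hb₁1.symm
  have hx₀A : x₀ ∈ A := (hmem x₀).2 (Or.inl rfl)
  have hx₁A : x₁ ∈ A := (hmem x₁).2 (Or.inr (Or.inl rfl))
  have hb₀A : b₀ ∉ A := fun h => (hAB b₀ h hb₀).1 rfl
  have hb₁A : b₁ ∉ A := fun h => (hAB b₁ h hb₁).2 rfl
  refine ⟨A, ?_, fun a ha1 => ?_, fun a => ?_⟩
  · -- cardinality `|A| = |B| - 2 + 2`
    have hcardB : (Finset.univ.filter fun g : H => g ∈ B).card = Nat.card B := by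
      rw [Nat.card_eq_fintype_card, ← Fintype.card_subtype]
    have hb₀f : b₀ ∈ (Finset.univ.filter fun g : H => g ∈ B) := Finset.mem_filter.2 ⟨Finset.mem_univ _, hb₀⟩
    have hb₁f : b₁ ∈ (Finset.univ.filter fun g : H => g ∈ B).erase b₀ := by
      rw [Finset.mem_erase, Finset.mem_filter]; exact ⟨hb₀₁.symm, Finset.mem_univ _, hb₁⟩
    have hx₁e : x₁ ∉ ((Finset.univ.filter fun g : H => g ∈ B).erase b₀).erase b₁ := fun h => by
      rw [Finset.mem_erase, Finset.mem_erase, Finset.mem_filter] at h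
      exact hx₁ h.2.2.2
    have hx₀e : x₀ ∉ insert x₁ (((Finset.univ.filter fun g : H => g ∈ B).erase b₀).erase b₁) := fun h => by
      rw [Finset.mem_insert, Finset.mem_erase, Finset.mem_erase, Finset.mem_filter] at h
      rcases h with h | h
      · exact hx₀₁ h
      · exact hx₀ h.2.2.2
    rw [hA_def, Finset.card_insert_of_notMem hx₀e, Finset.card_insert_of_notMem hx₁e,
      Finset.card_erase_of_mem hb₁f, Finset.card_erase_of_mem hb₀f, hcardB, ← two_mul_card_of_index_two hB]
    omega
  · -- aperiodic: some `q` with `¬ (q ∈ A ↔ a q ∈ A)`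
    by_cases haA : a ∈ A
    swap
    · exact ⟨1, fun h => haA (by rw [mul_one] at h; exact h.1 h1A)⟩
    by_cases haB : a ∈ B
    · obtain ⟨ha0, ha1'⟩ := hAB a haA haB
      by_cases k1 : a * x₀ = x₁
      swap
      · refine ⟨x₀, fun h => hout _ (fun hm => hx₀ (((hidx a x₀).1 hm).1 haB))
          (fun he => ha1 (mul_right_cancel (he.trans (one_mul x₀).symm))) k1 (h.1 hx₀A)⟩
      by_cases k2 : a * x₁ = x₀
      swap
      · refine ⟨x₁, fun h => hout _ (fun hm => hx₁ (((hidx a x₁).1 hm).1 haB)) k2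
          (fun he => ha1 (mul_right_cancel (he.trans (one_mul x₁).symm))) (h.1 hx₁A)⟩
      by_cases k3 : a⁻¹ * b₀ = b₁
      swap
      · refine ⟨a⁻¹ * b₀, fun h => hb₀A ?_⟩
        have hq : a⁻¹ * b₀ ∈ A := hBA _ (B.mul_mem (B.inv_mem haB) hb₀)
          (fun he => ha1 (inv_eq_one.1 (mul_right_cancel (he.trans (one_mul b₀).symm)))) k3
        have := h.1 hq
        rwa [mul_inv_cancel_left] at this
      by_cases k4 : a⁻¹ * b₁ = b₀
      swap
      · refine ⟨a⁻¹ * b₁, fun h => hb₁A ?_⟩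
        have hq : a⁻¹ * b₁ ∈ A := hBA _ (B.mul_mem (B.inv_mem haB) hb₁) k4
          (fun he => ha1 (inv_eq_one.1 (mul_right_cancel (he.trans (one_mul b₁).symm))))
        have := h.1 hq
        rwa [mul_inv_cancel_left] at this
      -- all four coincidences force `v = x₀⁻¹ b₀ u⁻¹ b₀⁻¹ x₀`
      exfalso
      have ha' : a⁻¹ = b₁ * b₀⁻¹ := by rw [← k3, mul_inv_cancel_right]
      have ha : a = b₀ * u⁻¹ * b₀⁻¹ := by
        rw [← inv_inv a, ha', hb₁_def, mul_inv_rev, mul_inv_rev, inv_inv, mul_assoc]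
      apply hvw
      calc v = x₀⁻¹ * x₁ := by rw [hx₁_def, inv_mul_cancel_left]
        _ = x₀⁻¹ * (a * x₀) := by rw [k1]
        _ = x₀⁻¹ * b₀ * u⁻¹ * b₀⁻¹ * x₀ := by rw [ha]; simp only [mul_assoc]
    · -- `a ∈ {x₀, x₁}`
      rcases hAout a haA haB with rfl | rfl
      · obtain ⟨q, hqB, hq0, hq1, hq1', hqv⟩ := exists_mem_ne_four h5 b₀ b₁ (1 : H) v
        refine ⟨q, fun h => hout (a * q) (fun hm => haB (((hidx a q).1 hm).2 hqB))
          (fun he => hq1' (mul_left_cancel (he.trans (mul_one a).symm)))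
          (fun he => hqv (mul_left_cancel (a := a) he)) (h.1 (hBA q hqB hq0 hq1))⟩
      · obtain ⟨q, hqB, hq0, hq1, hq1', hqv⟩ := exists_mem_ne_four h5 b₀ b₁ (1 : H) v⁻¹
        refine ⟨q, fun h => hout (x₀ * v * q) (fun hm => hx₁ (((hidx (x₀ * v) q).1 hm).2 hqB))
          (fun he => hqv ?_) (fun he => hq1' (mul_left_cancel (he.trans (mul_one _).symm)))
          (h.1 (hBA q hqB hq0 hq1))⟩
        have hvq : v * q = 1 := mul_left_cancel (a := x₀) (by rw [← mul_assoc, he, mul_one])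
        exact eq_inv_of_mul_eq_one_right hvq
  · -- nowhere self-complementary: some `q` with `q ∈ A ↔ a q ∈ A`
    by_cases haA : a ∈ A
    · exact ⟨1, by rw [mul_one]; exact ⟨fun _ => haA, fun _ => h1A⟩⟩
    by_cases haB : a ∈ B
    · -- `a ∈ {b₀, b₁}`
      have hab : a = b₀ ∨ a = b₁ := by
        by_contra h
        push Not at h
        exact haA (hBA a haB h.1 h.2)
      rcases hab with hab | hab
      · obtain ⟨q, hqB, hq0, hq1, hq1', hqu⟩ := exists_mem_ne_four h5 b₀ b₁ (1 : H) u
        refine ⟨q, ⟨fun _ => hBA _ (B.mul_mem haB hqB)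
          (fun he => hq1' (mul_left_cancel (a := a) (he.trans (by rw [mul_one, hab]))))
          (fun he => hqu (mul_left_cancel (a := a) (he.trans (by rw [hb₁_def, hab])))),
          fun _ => hBA q hqB hq0 hq1⟩⟩
      · obtain ⟨q, hqB, hq0, hq1, hq1', hqu⟩ := exists_mem_ne_four h5 b₀ b₁ (1 : H) (b₁⁻¹ * b₀)
        refine ⟨q, ⟨fun _ => hBA _ (B.mul_mem haB hqB) (fun he => hqu ?_)
          (fun he => hq1' (mul_left_cancel (a := a) (he.trans (by rw [mul_one, hab])))),
          fun _ => hBA q hqB hq0 hq1⟩⟩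
        rw [hab] at he
        rw [← he, inv_mul_cancel_left]
    · -- `a ∉ B`, `a ∉ {x₀, x₁}`
      have hax₀ : a ≠ x₀ := fun h => haA (h ▸ hx₀A)
      have hax₁ : a ≠ x₁ := fun h => haA (h ▸ hx₁A)
      have hab₀ : a * b₀ ∉ B := fun hm => haB (((hidx a b₀).1 hm).2 hb₀)
      have hab₁ : a * b₁ ∉ B := fun hm => haB (((hidx a b₁).1 hm).2 hb₁)
      by_cases l : a * b₀ ≠ x₀ ∧ a * b₀ ≠ x₁
      · exact ⟨b₀, ⟨fun h => absurd h hb₀A, fun h => absurd h (hout _ hab₀ l.1 l.2)⟩⟩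
      by_cases l' : a * b₁ ≠ x₀ ∧ a * b₁ ≠ x₁
      · exact ⟨b₁, ⟨fun h => absurd h hb₁A, fun h => absurd h (hout _ hab₁ l'.1 l'.2)⟩⟩
      exfalso
      rw [not_and_or, not_not, not_not] at l l'
      rcases l with l | l <;> rcases l' with l' | l'
      · exact hb₀₁ (mul_left_cancel (l.trans l'.symm))
      · -- `a b₀ = x₀`, `a b₁ = x₁ = x₀ v` ⟹ `u = v`
        apply hvu
        have h1 : x₀ * u = x₀ * v :=
          calc x₀ * u = a * b₀ * u := by rw [l]
            _ = a * b₁ := by rw [hb₁_def, mul_assoc]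
            _ = x₁ := l'
            _ = x₀ * v := hx₁_def
        exact (mul_left_cancel h1).symm
      · -- `a b₀ = x₁ = x₀ v`, `a b₁ = x₀` ⟹ `v u = 1`
        apply hvu'
        have h1 : x₀ * (v * u) = x₀ * 1 :=
          calc x₀ * (v * u) = x₁ * u := by rw [hx₁_def, mul_assoc]
            _ = a * b₀ * u := by rw [l]
            _ = a * b₁ := by rw [hb₁_def, mul_assoc]
            _ = x₀ * 1 := by rw [l', mul_one]
        exact eq_inv_of_mul_eq_one_left (mul_left_cancel h1)
      · exact hb₀₁ (mul_left_cancel (l.trans l'.symm))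

/-! ## §4 Corollaries -/

/-- **Groups of order `2k` with an element of order `k ≥ 5`** (`C_{2k}`, `D_k`, `Dic_{k/2}`, …) have an admissible
half. [folklore] -/
theorem exists_half_of_orderOf {g : H} {k : ℕ} (hg : orderOf g = k) (h5 : 5 ≤ k)
    (hcard : Fintype.card H = 2 * k) :
    ∃ A : Finset H, 2 * A.card = Fintype.card H ∧ (∀ a : H, a ≠ 1 → ∃ q, ¬ (q ∈ A ↔ a * q ∈ A)) ∧
      (∀ a : H, ∃ q, (q ∈ A ↔ a * q ∈ A)) := by
  have hBcard : Nat.card (Subgroup.zpowers g) = k := by rw [Nat.card_zpowers, hg]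
  have hB : (Subgroup.zpowers g).index = 2 := by
    have h := (Subgroup.zpowers g).index_mul_card
    rw [hBcard, Nat.card_eq_fintype_card, hcard] at h
    exact Nat.eq_of_mul_eq_mul_right (by omega) h
  exact exists_half_of_index_two hB (by rw [hBcard]; exact h5)

/-- **Groups of order `2p`, `p ≥ 5` prime** (`C_{2p}` and the dihedral group `D_p`) have an admissible half.
[folklore] -/
theorem exists_half_of_card_eq_two_mul_prime {p : ℕ} (hp : p.Prime) (h5 : 5 ≤ p)
    (hcard : Fintype.card H = 2 * p) :
    ∃ A : Finset H, 2 * A.card = Fintype.card H ∧ (∀ a : H, a ≠ 1 → ∃ q, ¬ (q ∈ A ↔ a * q ∈ A)) ∧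
      (∀ a : H, ∃ q, (q ∈ A ↔ a * q ∈ A)) := by
  haveI : Fact p.Prime := ⟨hp⟩
  obtain ⟨g, hg⟩ := exists_prime_orderOf_dvd_card p (by rw [hcard]; exact dvd_mul_left p 2)
  exact exists_half_of_orderOf hg h5 hcard

/-- **Groups of exponent `2` and order `≥ 16`** (`C₂ᵏ`, `k ≥ 4`) have an admissible half (an index-`2` subgroup
has order `2^{k-1} ≥ 8`); `C₂, C₂², C₂³` have none. [folklore] -/
theorem exists_half_of_exponent_two (hexp : ∀ h : H, h * h = 1) (h16 : 16 ≤ Fintype.card H) :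
    ∃ A : Finset H, 2 * A.card = Fintype.card H ∧ (∀ a : H, a ≠ 1 → ∃ q, ¬ (q ∈ A ↔ a * q ∈ A)) ∧
      (∀ a : H, ∃ q, (q ∈ A ↔ a * q ∈ A)) := by
  haveI : Fact (Nat.Prime 2) := ⟨Nat.prime_two⟩
  have hPG : IsPGroup 2 H := fun g => ⟨1, by rw [pow_one, pow_two, hexp]⟩
  obtain ⟨j, hj⟩ := IsPGroup.iff_card.1 hPG
  rw [Nat.card_eq_fintype_card] at hj
  have hj4 : 4 ≤ j := by
    by_contra hlt
    have : 2 ^ j ≤ 2 ^ 3 := Nat.pow_le_pow_right (by norm_num) (by omega)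
    omega
  have hsplit : 2 ^ j = 2 * 2 ^ (j - 1) := by rw [← pow_succ']; congr 1; omega
  obtain ⟨B, hBcard⟩ := Sylow.exists_subgroup_card_pow_prime (G := H) 2 (n := j - 1)
    (by rw [Nat.card_eq_fintype_card, hj, hsplit]; exact dvd_mul_left _ _)
  have hB : B.index = 2 := by
    have h := B.index_mul_card
    rw [hBcard, Nat.card_eq_fintype_card, hj, hsplit] at h
    exact Nat.eq_of_mul_eq_mul_right (by positivity) h
  have h8 : 2 ^ 3 ≤ 2 ^ (j - 1) := Nat.pow_le_pow_right (by norm_num) (by omega)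
  exact exists_half_of_index_two hB (by rw [hBcard]; omega)

end Summit.HodgeConjecture.CorCM.AdmissibleHalves
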